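import Summits.HodgeConjecture.CorCM.ReflexStabilizersCMHodge
import Literature.NumberTheory.NumberFields.ComplexAutomorphismsFixingIntersection
import HarnessLib

/-!
# Two CM abelian varieties whose types are defined over subfields of `ℂ` meeting in a real field:
# `Hg(A₀ × A₁) = Hg(A₀) × Hg(A₁)` and the Hodge conjecture on every `A₀^a × A₁^b`

COR-CM (cell `pub-hodgecm2`, binder seat `b16` gen 42, count-neutral claim CM33-QUADDISTINCT, file F2; theorems only, no
definition, no named fact, no `sorry`).  NEW as stated, hence under `Summits/`.  The FIELD form of this seat's
`CorCM/ReflexStabilizersCMHodge` (gen 41, F6): there the hypothesis was that the subgroup of `Aut(ℂ)` generated by the two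
type stabilisers `S_k = {σ | σΦ_{i_k} = Φ_{i_k}}` contains an element acting as complex conjugation on `Hom(K_{i₀}, ℂ)`.
By the Galois correspondence for `Aut(ℂ)` (`Literature/NumberTheory/NumberFields/ComplexAutomorphismsFixingIntersection`:
`⟨Aut(ℂ/E₀), Aut(ℂ/E₁)⟩ = Aut(ℂ/E₀ ∩ E₁)`) this holds as soon as there are subfields `E₀, E₁ ⊂ ℂ` of finite degree with

* `Aut(ℂ/E_k) ⊆ S_k` — `E_k` is a FIELD OF DEFINITION of the type `Φ_{i_k}`, i.e. contains its reflex field `K_k*`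
  (e.g. `E_k = K_k*`, or `E_k = φ(K_{i_k})` for an embedding `φ` whose stabiliser stabilises `Φ_{i_k}`, or the Galois
  closure), and
* complex conjugation fixes `E₀ ∩ E₁` pointwise — the two fields MEET IN A REAL FIELD (`E₀ ∩ E₁ ⊂ ℝ`; for
  conjugation-stable `E_k`: the number field `E₀ ∩ E₁` is totally real):

then conjugation itself lies in `⟨S₀ ∪ S₁⟩` and F6 applies:

* `conj_mem_closure_stabilizers_of_fixingFields_inf_real` (the hook, `g = ρ`);
* **`isNondegenerateFamily_iff_forall_of_fixingFields_inf_real`** — the pair `(Φ_{i₀}, Φ_{i₁})` is nondegenerate iff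
  both members are; `cmFamilyRank_add_card_eq_of_fixingFields_inf_real` (rank additivity);
* **`hodgeConjectureFor_prod_of_fixingFields_inf_real`**, `not_exists_exceptional_prod_of_fixingFields_inf_real` — for
  nondegenerate members: the Hodge conjecture and `B• = D•` on every `⨁_{j<N} A_{π j}`, no exceptional classes.

Compared with `CorCM/RealIntersectionCMFieldsHodge` (Galois CLOSURES meeting in a totally real field) the fields here
may be as small as the reflex fields, so the criterion sees pairs inside ONE Galois closure (consumer:
`CorCM/DistinctImaginaryQuadraticSexticCMHodge`, the sextic fields `F k₀`, `F k₁`).  HC_CM is not touched.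

## References

* [Gordon1999HodgeAVSurvey] B. B. Gordon, *A survey of the Hodge conjecture for abelian varieties*, §3 Theorem (proof),
  7.5–7.7, 10.10.
* [Shimura1998] G. Shimura, *Abelian Varieties with Complex Multiplication and Modular Functions*, §8.3 (reflex field).
* [Lang2002] S. Lang, *Algebra*, 3rd ed., VI §1 Thm. 1.1, Cor. 1.6 (Galois correspondence).
-/

noncomputable section

open CategoryTheory CategoryTheory.Limits NumberField Module

namespace Summit.HodgeConjecture.CorCM

open Literature.NumberTheory.ComplexMultiplication
open Literature.NumberTheory.NumberFields (conj_mem_closure_fixing_union_iff)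
open Literature.AlgebraicGeometry.Motives (AbelianVariety CMType)
open Literature.AlgebraicGeometry.HodgeTheory
open Literature.AlgebraicGeometry.ComplexMultiplication (IsCMTypeRealisation)
open Literature.AlgebraicGeometry.VanGeemen1994 (hodgeClassSpan)
open Literature.AlgebraicGeometry.Pohlmann1968
open Literature.Barriers.HodgeConjecture (divisorClassesSpan)

variable {I : Type} {K : I → Type} [∀ i, Field (K i)] [∀ i, NumberField (K i)] [∀ i, IsCMField (K i)] [Fintype I]
  [DecidableEq I] [Nonempty I] {Φ : ∀ i, CMType (K i)}

/-! ## §1 The hook: conjugation is generated by the two stabilisers -/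

section Hook

omit [∀ i, NumberField (K i)] [∀ i, IsCMField (K i)] [Fintype I] [DecidableEq I] [Nonempty I] in
/-- **Fields of definition meeting in a real field put complex conjugation in `⟨S₀ ∪ S₁⟩`.**  If `Aut(ℂ/E_k)` stabilises
`Φ_{i_k}` (`k = 0, 1`) for subfields `E₀, E₁ ⊂ ℂ` of finite degree and complex conjugation fixes `E₀ ∩ E₁` pointwise,
then conjugation is a product of automorphisms of `ℂ` each stabilising `Φ_{i₀}` or `Φ_{i₁}` — the hypothesis `hg` of
`isNondegenerateFamily_iff_forall_of_conj_mem_closure_stabilizers` with `g = ρ`.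
[cite: Lang2002, VI §1 Thm. 1.1 and Cor. 1.6] [cite: Shimura1998, §8.3] -/
theorem conj_mem_closure_stabilizers_of_fixingFields_inf_real {i₀ i₁ : I} (E₀ E₁ : IntermediateField ℚ ℂ)
    [FiniteDimensional ℚ E₀] [FiniteDimensional ℚ E₁]
    (hE₀ : ∀ σ : ℂ ≃+* ℂ, (∀ z : ℂ, z ∈ E₀ → σ z = z) → ∀ x : K i₀ →+* ℂ, σ • x ∈ (Φ i₀).1 ↔ x ∈ (Φ i₀).1)
    (hE₁ : ∀ σ : ℂ ≃+* ℂ, (∀ z : ℂ, z ∈ E₁ → σ z = z) → ∀ y : K i₁ →+* ℂ, σ • y ∈ (Φ i₁).1 ↔ y ∈ (Φ i₁).1)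
    (hreal : ∀ z : ℂ, z ∈ E₀ → z ∈ E₁ → starRingEnd ℂ z = z) :
    ∃ g ∈ Subgroup.closure
        ({s : ℂ ≃+* ℂ | ∀ x : K i₀ →+* ℂ, s • x ∈ (Φ i₀).1 ↔ x ∈ (Φ i₀).1} ∪
          {s : ℂ ≃+* ℂ | ∀ y : K i₁ →+* ℂ, s • y ∈ (Φ i₁).1 ↔ y ∈ (Φ i₁).1}),
      ∀ x : K i₀ →+* ℂ, g • x = (starRingAut : ℂ ≃+* ℂ) • x :=
  ⟨starRingAut,
    Subgroup.closure_mono (Set.union_subset_union (fun σ hσ => hE₀ σ hσ) (fun σ hσ => hE₁ σ hσ))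
      (conj_mem_closure_fixing_union_iff.2 hreal),
    fun _ => rfl⟩

end Hook

/-! ## §2 Types -/

section Types

omit [∀ i, IsCMField (K i)] [Fintype I] [DecidableEq I] [Nonempty I] in
/-- An automorphism of `ℂ` fixing the image `φ(K)` pointwise fixes the embedding `φ`: so if the stabiliser of ONE
embedding `φ` stabilises the type `Φ`, then `E = φ(K)` (`φ.toRatAlgHom.fieldRange`) is a field of definition of `Φ` in
the sense of this file. [cite: Shimura1998, §8.3] -/
theorem forall_smul_mem_iff_of_forall_apply_fieldRange_eq {i : I} (φ : K i →+* ℂ)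
    (hφ : ∀ σ : ℂ ≃+* ℂ, σ • φ = φ → ∀ x : K i →+* ℂ, σ • x ∈ (Φ i).1 ↔ x ∈ (Φ i).1) (σ : ℂ ≃+* ℂ)
    (hσ : ∀ z : ℂ, z ∈ φ.toRatAlgHom.fieldRange → σ z = z) :
    ∀ x : K i →+* ℂ, σ • x ∈ (Φ i).1 ↔ x ∈ (Φ i).1 :=
  hφ σ (RingHom.ext fun a => by
    rw [ringEquiv_smul_apply]
    exact hσ (φ a) (AlgHom.mem_fieldRange.2 ⟨a, rfl⟩))

/-- **Fields of definition meeting in a real field ⟹ the pair is nondegenerate iff its members are**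
(`Hg(A₀ × A₁) = Hg(A₀) × Hg(A₁)`).  Hypotheses: `I = {i₀, i₁}`; subfields `E₀, E₁ ⊂ ℂ` of finite degree with
`Aut(ℂ/E_k) ⊆ Stab(Φ_{i_k})` (fields of definition of the types, e.g. the reflex fields) and `E₀ ∩ E₁ ⊂ ℝ`.
[cite: Gordon1999HodgeAVSurvey, §3 Theorem and 7.5–7.7] [cite: Shimura1998, §8.3] -/
theorem isNondegenerateFamily_iff_forall_of_fixingFields_inf_real {i₀ i₁ : I} (h01 : i₀ ≠ i₁)
    (hI : ∀ j, j = i₀ ∨ j = i₁) (E₀ E₁ : IntermediateField ℚ ℂ) [FiniteDimensional ℚ E₀] [FiniteDimensional ℚ E₁]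
    (hE₀ : ∀ σ : ℂ ≃+* ℂ, (∀ z : ℂ, z ∈ E₀ → σ z = z) → ∀ x : K i₀ →+* ℂ, σ • x ∈ (Φ i₀).1 ↔ x ∈ (Φ i₀).1)
    (hE₁ : ∀ σ : ℂ ≃+* ℂ, (∀ z : ℂ, z ∈ E₁ → σ z = z) → ∀ y : K i₁ →+* ℂ, σ • y ∈ (Φ i₁).1 ↔ y ∈ (Φ i₁).1)
    (hreal : ∀ z : ℂ, z ∈ E₀ → z ∈ E₁ → starRingEnd ℂ z = z) :
    CMAlgebra.IsNondegenerateFamily Φ ↔ ∀ i, IsNondegenerate (Φ i) :=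
  isNondegenerateFamily_iff_forall_of_conj_mem_closure_stabilizers h01 hI
    (conj_mem_closure_stabilizers_of_fixingFields_inf_real E₀ E₁ hE₀ hE₁ hreal)

/-- **Rank additivity** `rank(Φ₀, Φ₁) + 2 = rank Φ₀ + rank Φ₁ + 1` under the same hypotheses.
[cite: Gordon1999HodgeAVSurvey, §3 Theorem (1)] -/
theorem cmFamilyRank_add_card_eq_of_fixingFields_inf_real {i₀ i₁ : I} (h01 : i₀ ≠ i₁)
    (hI : ∀ j, j = i₀ ∨ j = i₁) (E₀ E₁ : IntermediateField ℚ ℂ) [FiniteDimensional ℚ E₀] [FiniteDimensional ℚ E₁]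
    (hE₀ : ∀ σ : ℂ ≃+* ℂ, (∀ z : ℂ, z ∈ E₀ → σ z = z) → ∀ x : K i₀ →+* ℂ, σ • x ∈ (Φ i₀).1 ↔ x ∈ (Φ i₀).1)
    (hE₁ : ∀ σ : ℂ ≃+* ℂ, (∀ z : ℂ, z ∈ E₁ → σ z = z) → ∀ y : K i₁ →+* ℂ, σ • y ∈ (Φ i₁).1 ↔ y ∈ (Φ i₁).1)
    (hreal : ∀ z : ℂ, z ∈ E₀ → z ∈ E₁ → starRingEnd ℂ z = z) :
    CMAlgebra.cmFamilyRank Φ + Fintype.card I = (∑ i, cmTypeRank (Φ i)) + 1 :=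
  cmFamilyRank_add_card_eq_of_conj_mem_closure_stabilizers h01 hI
    (conj_mem_closure_stabilizers_of_fixingFields_inf_real E₀ E₁ hE₀ hE₁ hreal)

end Types

/-! ## §3 Abelian varieties -/

section Geometry

variable {A : I → AbelianVariety ℂ} {ι : ∀ i, 𝓞 (K i) →+* End (A i)}
  {θ : ∀ i, K i →+* Module.End ℂ (complexBetti (A i).X 1)}

/-- **The Hodge conjecture on every `A₀^a × A₁^b`** (every `⨁_{j<N} A_{π j}`), with `B• = D•` there, for realisations of
NONDEGENERATE types with fields of definition meeting in a real field — UNCONDITIONAL.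
[cite: Gordon1999HodgeAVSurvey, §3 Theorem and 10.10] -/
theorem hodgeConjectureFor_prod_of_fixingFields_inf_real {i₀ i₁ : I} (h01 : i₀ ≠ i₁) (hI : ∀ j, j = i₀ ∨ j = i₁)
    (E₀ E₁ : IntermediateField ℚ ℂ) [FiniteDimensional ℚ E₀] [FiniteDimensional ℚ E₁]
    (hE₀ : ∀ σ : ℂ ≃+* ℂ, (∀ z : ℂ, z ∈ E₀ → σ z = z) → ∀ x : K i₀ →+* ℂ, σ • x ∈ (Φ i₀).1 ↔ x ∈ (Φ i₀).1)
    (hE₁ : ∀ σ : ℂ ≃+* ℂ, (∀ z : ℂ, z ∈ E₁ → σ z = z) → ∀ y : K i₁ →+* ℂ, σ • y ∈ (Φ i₁).1 ↔ y ∈ (Φ i₁).1)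
    (hreal : ∀ z : ℂ, z ∈ E₀ → z ∈ E₁ → starRingEnd ℂ z = z)
    (hnd : ∀ i, IsNondegenerate (Φ i)) (hA : ∀ i, IsCMTypeRealisation (Φ i) (A i) (ι i) (θ i)) {N : ℕ}
    (π : Fin N → I) :
    HodgeConjectureFor (⨁ fun j : Fin N => A (π j)).dim (⨁ fun j : Fin N => A (π j)).X ∧
      ∀ m : ℕ, hodgeClassSpan (⨁ fun j : Fin N => A (π j)).dim (⨁ fun j : Fin N => A (π j)).X m =
        divisorClassesSpan (⨁ fun j : Fin N => A (π j)).X (⨁ fun j : Fin N => A (π j)).dim m :=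
  hodgeConjectureFor_prod_of_conj_mem_closure_stabilizers h01 hI
    (conj_mem_closure_stabilizers_of_fixingFields_inf_real E₀ E₁ hE₀ hE₁ hreal) hnd hA π

/-- **No exceptional Hodge class on any `A₀^a × A₁^b`** under the same hypotheses.
[cite: Gordon1999HodgeAVSurvey, 7.5 and 7.6.1] -/
theorem not_exists_exceptional_prod_of_fixingFields_inf_real {i₀ i₁ : I} (h01 : i₀ ≠ i₁)
    (hI : ∀ j, j = i₀ ∨ j = i₁) (E₀ E₁ : IntermediateField ℚ ℂ) [FiniteDimensional ℚ E₀] [FiniteDimensional ℚ E₁]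
    (hE₀ : ∀ σ : ℂ ≃+* ℂ, (∀ z : ℂ, z ∈ E₀ → σ z = z) → ∀ x : K i₀ →+* ℂ, σ • x ∈ (Φ i₀).1 ↔ x ∈ (Φ i₀).1)
    (hE₁ : ∀ σ : ℂ ≃+* ℂ, (∀ z : ℂ, z ∈ E₁ → σ z = z) → ∀ y : K i₁ →+* ℂ, σ • y ∈ (Φ i₁).1 ↔ y ∈ (Φ i₁).1)
    (hreal : ∀ z : ℂ, z ∈ E₀ → z ∈ E₁ → starRingEnd ℂ z = z)
    (hnd : ∀ i, IsNondegenerate (Φ i)) (hA : ∀ i, IsCMTypeRealisation (Φ i) (A i) (ι i) (θ i)) {N : ℕ}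
    (π : Fin N → I) (m : ℕ) :
    ¬∃ c : complexBetti (⨁ fun j : Fin N => A (π j)).X (2 * m), IsRationalClass c ∧
        IsOfHodgeType (⨁ fun j : Fin N => A (π j)).dim (⨁ fun j : Fin N => A (π j)).X (2 * m) m m c ∧
        c ∉ divisorClassesSpan (⨁ fun j : Fin N => A (π j)).X (⨁ fun j : Fin N => A (π j)).dim m :=
  not_exists_exceptional_prod_of_conj_mem_closure_stabilizers h01 hI
    (conj_mem_closure_stabilizers_of_fixingFields_inf_real E₀ E₁ hE₀ hE₁ hreal) hnd hA π m

end Geometry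

end Summit.HodgeConjecture.CorCM

end
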